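import Mathlib
import Summits.Ventures.PercRepro2.RowC1E1Avoid
import Summits.Ventures.PercRepro2.BHKEvents

/-!
# The symmetric anticorrelation bounds of row 2′C1 (blind cell PercRepro2, p2 g30; proofs/P2-G30-C1.md §6)

With `Q = {a₁ ↮ a₂}`, `C₁ = C(a₁)`, `C₂ = C(a₂)`, `U = C₁ ∪ C₂`, `μ = P(· | Q)`, the row reads
`Cov_μ(1[b ∈ U], 1[o ∈ U]) ≥ −μ(b ∈ C₁)·μ(o ∈ U)`.  The symmetric family of this seat is

  **(S_{x,y})**  `Cov_μ(1[b ∈ U], 1[o ∈ U]) ≥ −μ(b ↔ x)·μ(o ↔ y)`   for roots `x, y ∈ {a₁, a₂}`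

(`SymBound`, cleared by `P(Q)²`): the anticorrelation of the two root-cluster memberships is at most
the product of ANY two single-root memberships — in particular (`x = y = a₁`, `x = y = a₂`, the two
cross choices) at most `min{μ(b ∈ C₁), μ(b ∈ C₂)}·min{μ(o ∈ C₁), μ(o ∈ C₂)}`.  This file proves
* **`c1_of_symBound`**: `S_{a₁,y}` (any root `y`) implies row 2′C1 (`{o ↔ y} ⊆ {o ∈ U}` on `Q`);
* **`e1_of_symBound`**: `S_{a₁,a₁}` implies (E1) (`E1Cov`), by the cross-cluster repulsion
  `bhk_cross_cluster` (BHK06 Thm 1.4): `P(Q, b ∈ C₁, o ∈ C₂)·P(Q) ≤ P(Q, b ∈ C₁)·P(Q, o ∈ C₂)`.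
Every `S_{x,y}` is a CONJECTURE of the cell (exact census 0 / 1,100 at n ≤ 6, log-odds descents
0 / 682 per member; their cluster-conditioned (Rao–Blackwell) versions are FALSE — the within-cluster
Harris slack is part of the statement; proofs/P2-G30-C1.md §6), not a fact.
-/

namespace Summit.Ventures.PercRepro2

namespace RowC1

section Sym

variable {V : Type*} {E : Type*} [Fintype E] [DecidableEq E]
  {R : Type*} [CommRing R] [LinearOrder R] [IsStrictOrderedRing R]

/-- **(S_{x,y})**, cleared by `P(Q)²`:
`P(Q, b ∈ U)·P(Q, o ∈ U) ≤ P(Q)·P(Q, b ∈ U, o ∈ U) + P(Q, x ↔ b)·P(Q, y ↔ o)`, i.e.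
`Cov_μ(1[b ∈ U], 1[o ∈ U]) ≥ −μ(b ↔ x)·μ(o ↔ y)`.  A CONJECTURE for `x, y ∈ {a₁, a₂}` (p2 g30). -/
def SymBound (p : E → R) (ends : E → Sym2 V) (a₁ a₂ o b x y : V) : Prop :=
  prob p ((connEvent ends a₁ b ∪ connEvent ends a₂ b) ∩ (connEvent ends a₁ a₂)ᶜ) *
      prob p ((connEvent ends a₁ o ∪ connEvent ends a₂ o) ∩ (connEvent ends a₁ a₂)ᶜ) ≤
    prob p (connEvent ends a₁ a₂)ᶜ *
      prob p ((connEvent ends a₁ o ∪ connEvent ends a₂ o) ∩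
        (connEvent ends a₁ b ∪ connEvent ends a₂ b) ∩ (connEvent ends a₁ a₂)ᶜ) +
    prob p (connEvent ends x b ∩ (connEvent ends a₁ a₂)ᶜ) *
      prob p (connEvent ends y o ∩ (connEvent ends a₁ a₂)ᶜ)

omit [LinearOrder R] [IsStrictOrderedRing R] in
/-- `P(Q, b ∈ U) = P(Q, b ∈ C₂) + P(Q, b ∈ C₁)` (disjoint on `Q`). -/
lemma prob_bU_eq (p : E → R) (ends : E → Sym2 V) (a₁ a₂ b : V) :
    prob p ((connEvent ends a₁ b ∪ connEvent ends a₂ b) ∩ (connEvent ends a₁ a₂)ᶜ) =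
      prob p (connEvent ends a₂ b ∩ (connEvent ends a₁ a₂)ᶜ) +
        prob p (connEvent ends a₁ b ∩ (connEvent ends a₁ a₂)ᶜ) := by
  rw [← prob_union_of_disjoint p]
  · congr 1
    ext ω
    simp only [Set.mem_inter_iff, Set.mem_union]
    tauto
  · rw [Set.disjoint_left]
    rintro ω ⟨hb2, hQ⟩ ⟨hb1, -⟩
    exact hQ (conn_trans hb1 (conn_symm hb2))

/-- **Row 2′C1 from `S_{a₁,y}`** for any root `y ∈ {a₁, a₂}`. -/
theorem c1_of_symBound (p : E → R) (hp : IsProbVec p) (ends : E → Sym2 V) (a₁ a₂ o b y : V)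
    (hy : y = a₁ ∨ y = a₂) (h : SymBound p ends a₁ a₂ o b a₁ y) :
    prob p (connEvent ends a₂ b ∩ (connEvent ends a₁ a₂)ᶜ) *
      prob p ((connEvent ends a₁ o ∪ connEvent ends a₂ o) ∩ (connEvent ends a₁ a₂)ᶜ) ≤
    prob p (connEvent ends a₁ a₂)ᶜ *
      prob p ((connEvent ends a₁ o ∪ connEvent ends a₂ o) ∩
        (connEvent ends a₁ b ∪ connEvent ends a₂ b) ∩ (connEvent ends a₁ a₂)ᶜ) := by
  unfold SymBound at h
  rw [prob_bU_eq] at h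
  -- `{o ↔ y} ∩ Q ⊆ {o ∈ U} ∩ Q`
  have hsub : prob p (connEvent ends y o ∩ (connEvent ends a₁ a₂)ᶜ) ≤
      prob p ((connEvent ends a₁ o ∪ connEvent ends a₂ o) ∩ (connEvent ends a₁ a₂)ᶜ) := by
    refine prob_mono hp ?_
    rintro ω ⟨ho, hQ⟩
    refine ⟨?_, hQ⟩
    rcases hy with rfl | rfl
    · exact Or.inl ho
    · exact Or.inr ho
  have h0 : 0 ≤ prob p (connEvent ends a₁ b ∩ (connEvent ends a₁ a₂)ᶜ) := prob_nonneg hp _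
  nlinarith [h, hsub, h0, mul_le_mul_of_nonneg_left hsub h0]

/-- **(E1) from `S_{a₁,a₁}`**: the cross-cluster repulsion `P(Q, b ∈ C₁, o ∈ C₂)·P(Q) ≤
P(Q, b ∈ C₁)·P(Q, o ∈ C₂)` (`bhk_cross_cluster`) turns `Cov_μ(bU, oU) ≥ −μ(b ∈ C₁)μ(o ∈ C₁)` into
`Cov_μ(1[b ∈ C₂], 1[o ∈ U]) ≥ −μ(b ∈ C₁, o ∈ C₁)`. -/
theorem e1_of_symBound [Fintype V] [DecidableEq V] (p : E → R) (hp : IsProbVec p)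
    (ends : E → Sym2 V) (a₁ a₂ o b : V) (h : SymBound p ends a₁ a₂ o b a₁ a₁) :
    E1Cov p ends a₁ a₂ o b := by
  unfold SymBound at h
  unfold E1Cov
  rw [prob_bU_eq] at h
  set Q := (connEvent ends a₁ a₂)ᶜ with hQdef
  set BH := connEvent ends a₂ b with hBH
  set BL := connEvent ends a₁ b with hBL
  set OU := connEvent ends a₁ o ∪ connEvent ends a₂ o with hOU
  set OL := connEvent ends a₁ o with hOL
  set OH := connEvent ends a₂ o with hOH
  -- `P(Q, o ∈ U) = P(Q, o ∈ C₁) + P(Q, o ∈ C₂)`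
  have eoU : prob p (OU ∩ Q) = prob p (OL ∩ Q) + prob p (OH ∩ Q) := by
    rw [← prob_union_of_disjoint p]
    · congr 1
      ext ω
      simp only [hOU, Set.mem_inter_iff, Set.mem_union]
      tauto
    · rw [Set.disjoint_left]
      rintro ω ⟨ho1, hQ⟩ ⟨ho2, -⟩
      exact hQ (conn_trans ho1 (conn_symm ho2))
  -- `P(Q, o ∈ U, b ∈ U) = P(Q, b ∈ C₂, o ∈ U) + P(Q, b ∈ C₁, o ∈ C₁) + P(Q, b ∈ C₁, o ∈ C₂)`
  have ebUoU : prob p (OU ∩ (BL ∪ BH) ∩ Q) =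
      prob p (BH ∩ OU ∩ Q) + prob p (BL ∩ OL ∩ Q) + prob p (BL ∩ OH ∩ Q) := by
    rw [← prob_union_of_disjoint p, ← prob_union_of_disjoint p]
    · congr 1
      ext ω
      simp only [hOU, Set.mem_inter_iff, Set.mem_union]
      constructor
      · rintro ⟨⟨ho, hb⟩, hQ⟩
        rcases hb with hb1 | hb2
        · rcases ho with ho1 | ho2
          · exact Or.inl (Or.inr ⟨⟨hb1, ho1⟩, hQ⟩)
          · exact Or.inr ⟨⟨hb1, ho2⟩, hQ⟩
        · exact Or.inl (Or.inl ⟨⟨hb2, ho⟩, hQ⟩)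
      · rintro ((⟨⟨hb2, ho⟩, hQ⟩ | ⟨⟨hb1, ho1⟩, hQ⟩) | ⟨⟨hb1, ho2⟩, hQ⟩)
        · exact ⟨⟨ho, Or.inr hb2⟩, hQ⟩
        · exact ⟨⟨Or.inl ho1, Or.inl hb1⟩, hQ⟩
        · exact ⟨⟨Or.inr ho2, Or.inl hb1⟩, hQ⟩
    · rw [Set.disjoint_left]
      rintro ω (⟨⟨hb2, -⟩, hQ⟩ | ⟨⟨-, ho1⟩, hQ⟩) ⟨⟨hb1, ho2⟩, -⟩
      · exact hQ (conn_trans hb1 (conn_symm hb2))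
      · exact hQ (conn_trans ho1 (conn_symm ho2))
    · rw [Set.disjoint_left]
      rintro ω ⟨⟨hb2, -⟩, hQ⟩ ⟨⟨hb1, -⟩, -⟩
      exact hQ (conn_trans hb1 (conn_symm hb2))
  -- the cross-cluster repulsion (BHK06 Thm 1.4)
  have hrep : prob p (BL ∩ OH ∩ Q) * prob p Q ≤ prob p (BL ∩ Q) * prob p (OH ∩ Q) := by
    have := bhk_cross_cluster p hp ends a₁ a₂ (𝓤 := {S : Set V | b ∈ S}) (𝓥 := {S : Set V | o ∈ S})
      (fun S S' hSS' hS => hSS' hS) (fun S S' hSS' hS => hSS' hS)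
    have e1 : clusterInEvent ends a₁ {S : Set V | b ∈ S} = BL := by
      ext ω; exact Iff.rfl
    have e2 : clusterInEvent ends a₂ {S : Set V | o ∈ S} = OH := by
      ext ω; exact Iff.rfl
    rw [e1, e2] at this
    exact this
  have h0 : 0 ≤ prob p (BL ∩ Q) := prob_nonneg hp _
  have h0' : 0 ≤ prob p (OH ∩ Q) := prob_nonneg hp _
  rw [ebUoU] at h
  rw [eoU] at h ⊢
  nlinarith [h, hrep, h0, h0', mul_le_mul_of_nonneg_left hrep h0]

end Sym

end RowC1

end Summit.Ventures.PercRepro2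

/-!
## ERRATUM (p2 g30, after kit j328129 — appended, no declaration changed)

The header above calls every `S_{x,y}` with `x, y ∈ {a₁, a₂}` a conjecture.  That is true only of the
SAME-SIDE members `(x, y) = (a₁, a₁)` and `(a₂, a₂)` (0 / 432,024 log-odds descents on 144,008 graphs
`n = 6–8`, kit j328129).  The CROSS members `(a₁, a₂)` and `(a₂, a₁)` are FALSE: 187 and 165 exact
negatives there, and RowC1SymCounterexample6.lean refutes `SymBound p8 g6t 0 1 2 5 0 1` in the kernel
(`not_symBound_cross_g6t`; on `g6t` the cross member coincides with the refuted (TRI-COV)).  The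
theorems of this file use only the same-side member `S_{a₁,a₁}`; the conjecture of record is
`Cov_μ(1[b ∈ U], 1[o ∈ U]) ≥ −min{μ(b ∈ C₁)·μ(o ∈ C₁), μ(b ∈ C₂)·μ(o ∈ C₂)}` (proofs/P2-G30-C1.md §6 v4).
-/

/-!
## ERRATUM 2 (p2 g30, after kit j328854 — appended, no declaration changed)

The SAME-SIDE members are false as well: ratio-maximising log-odds descents (429,801 restarts on random
connected graphs `n = 6–8`, exact re-check) give 109 exact negatives for `(x, y) = (a₁, a₁)` and 119 for
`(a₂, a₂)` — e.g. `n = 7`, edges `02 04 06 12 13 25 26 35 36 46`, `(a₁, a₂, o, b) = (1, 0, 4, 5)`,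
`w = (.999877, .999569, .999877, .999876, .243127, .803739, .999877, .210544, .795511, .00065)`:
`Cov_μ(1[b ∈ U], 1[o ∈ U]) = −1.3139·10⁻¹³ < −μ(b ∈ C₁)·μ(o ∈ C₁) = −1.1921·10⁻¹³` (three independent
exact evaluations; data/p2/g30/j328854/).  So every `SymBound` with `x, y ∈ {a₁, a₂}` is FALSE in general;
`c1_of_symBound` and `e1_of_symBound` stand as implications with false hypotheses.  Row 2′C1 and (E1) hold
at that witness (slacks `2.8·10⁻³`, `7.2·10⁻¹¹`).  proofs/P2-G30-C1.md §8.
-/
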